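import Literature.MathematicalPhysics.QuantumFieldTheory.Balaban1983to89.B6Ineq249MultiLevelBox
import Literature.MathematicalPhysics.QuantumFieldTheory.Balaban1983to89.B6Geom246MultiLevelBox
import Literature.MathematicalPhysics.QuantumFieldTheory.Balaban1983to89.B6Prop23Chain

/-!
# `Balaban1983to89.B6Prop22MultiLevelBox` — [B6] PROPOSITION 2.2, FIRST ENTRY OF (2.67), FOR THE GENUINE `k`-LEVEL
OPERATOR `G′ = Δ′_a^{−1}` ON A BOX: `|(G′λ)(x)| ≤ O(1)(L^jη)²e^{−½δ₀d(y,y′)}|λ|`, `x ∈ B^j(y)`, `supp λ ⊂ B^{j′}(y′)` —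
by the printed route (2.64)–(2.66): the majorants of `R` (2.64) and of `G′₀` on `𝔅` from the cube estimates
(2.43)/(2.44) of the genuine two-level cube operators, the fixed point `G′ = G′₀ + G′R` of (2.38)/(2.50), and the chain
of Lemma 2.1 (file 5 of the multi-level parametrix; no existing module is touched; no fact is minted)

FRAMING (verbatim cell line):
statement-level skeleton of published theorems with citation tags; proofs where landed; nothing here is a claim about the Yang–Mills mass gap

Source under audit (cell pub-balaban / lit-balaban): T. Bałaban, *Propagators and renormalization transformations for
lattice gauge theories. II*, Commun. Math. Phys. **96** (1984) 223–250 [`Balaban1984PropagatorsII`, "B6"], p. 232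
[PDF 10] (2.51)–(2.55), p. 234 [PDF 12] (2.64)–(2.67), Proposition 2.2 (render
`run/shared/lean/pub/pub-balaban/b2b-balaban-ref1/pages/1984-cmp96-propagators-rt-II/…-p010-x2.png`, `-p012-x2.png`, read
as images this generation).  Unit `lit-balaban-p21` (Phase-2 proof seat p21 gen 10), HOME `run/shared/lean/pub/lit-balaban/`,
B6 fold owner r03, referee ref-4.

## WHAT IS PRINTED (p. 234, verbatim up to notation)

«From the lemma and (2.55) we get |(Rλ)(x)| ≤ O(1)ⁿc₁ⁿe^{−½δ₀d(y,y′)}|λ|, x ∈ B^j(y), supp λ ⊂ B^{j′}(y′). (2.64)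
Applying this inequality to the n^{th} power of the operator R in (2.38) we have |(Rⁿλ)(x)| ≤ (O(M^{−1})c₁)ⁿ
e^{−½δ₀d(y,y′)}|λ|, (2.65) and this implies finally for x ∈ B^j(y), supp λ ⊂ B^{j′}(y′),
|(G′λ)(x)| ≤ Σ_{n=0}^∞ |(G′₀Rⁿλ)(x)| ≤ … ≤ O(1)(L^jη)²e^{−½δ₀d(y,y′)}|λ|. (2.66) …
**Proposition 2.2.** If we have (2.1), (2.2) and M is sufficiently large, then the operator G′ = Δ′_a^{−1} (a = 1)
satisfies the inequalities |(G′λ)(x)|, … ≤ O(1)[(L^jη)², …]·e^{−½δ₀d(y,y′)}|λ|, x ∈ B^j(y) …, y ∈ Λ_j,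
supp λ ⊂ B^{j′}(y′), y′ ∈ Λ_{j′}. (2.67)»

## WHAT THIS FILE CERTIFIES (kernel-checked; setting of files 1–4)

For the genuine `k`-level operator `Δ′_a = mlOp` of a nested family `D : Domains d ℓ M_h k P R` on the box, its cover
`𝒟`, `G′₀ = gZeroML`, `R = rML` (file 2), the blocks `𝔅`, `y(x) = blkOf x` and the distance `d` of `geom D` (file 4),
in the majorant language of `B6RandomWalk` (`HasMajorant blk T K`: «|(Tλ)(x)| ≤ K(y,y′)|λ|, x ∈ B^j(y),
supp λ ⊂ B^{j′}(y′)»):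
* §2 cube geometry: every box site of an active cube has level `i_□` or `i_□ + 1` (`lev_window_of_inCube`), so `d`
  between blocks met by the cube is at most `(d+1)(|x − x″|_∞/L^{i_□} + 1)` (`dist_blkOf_le_in_cube`, file 4);
* §3 **(2.64) FOR THE GENUINE OPERATOR** `rML_majorant`: `R` has the majorant `(K/M)·e^{−δ₁d(y,y′)/(d+1)}` for all
  `k`, `M_h ≥ 3`, `R ≥ 2L`, volumes, families `D` and weights in the windows — from file 3's (2.44)-with-right-factor
  `local_comm_bound` in its decaying form per cube, §2, and the finite overlap of the cover;
* §4 **THE MAJORANT OF `G′₀`** `gZeroML_majorant`: `A·L^{2j}·e^{−δ₂d(y,y′)/(d+1)}` (`y ∈ Λ_j`) — from (2.43) per cube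
  (`B6Ineq243TwoLevelBox.ineq243_twoLevel_roww`, `B4Thm110ZeroBox.mulVec_le_of_roww`), the factor `L^{2i_□} ≤ L^{2j}`
  of the lattice-unit cube propagator, §2 and the finite overlap;
* §5 **PROPOSITION 2.2, FIRST ENTRY, FOR THE GENUINE `k`-LEVEL OPERATOR** `prop22_first_multiLevelBox`: there are
  `δ₀, C, M₀ > 0` and `N₀` (functions of `d`, `ℓ` and the windows) such that for every `k`, `M_h ≥ 3` with
  `L·M_h ≥ M₀` («M is sufficiently large»), `R ≥ 2L` with `R·M ≥ N₀ + 1` ((2.59)), every volume `P`, nested family `D`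
  ((2.1)–(2.2)) and weights in the windows with `a_{i+1} = aNext ℓ a_i c_i`:
  `|(G′λ)(x)| ≤ C·L^{2j}·e^{−½δ₀d(y,y′)}|λ|` for `x ∈ B^j(y)`, `supp λ ⊂ B^{j′}(y′)` — the fixed point
  `G′ = G′₀ + G′R` (from (2.38) `Δ′_aG′₀ = 1 − R` and `G′Δ′_a = 1`) fed, with §3–§4 and Lemma 2.1 on the box
  (`B6Geom246MultiLevelBox.lemma21_box`, `α = ½`), to the chain `B6Prop23Chain.majorant_of_fixedPoint_266W`.

## HONEST SCOPE

As files 1–4: levels `1 … k` on a Neumann box (print: torus, `j = 0 … k` with `Λ₀`, `a₀ = +∞`), `m² = 0`, the asymmetric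
partition, `M_h ≥ 3`; lattice units (`G′` here is `η^{−2}·G′` of print, whence `L^{2j}` for «(L^jη)²»); the
(2.61)-constant is the `L`-dependent series constant of `B6Ineq261LevelGap` (print's `c₁(α)` is refuted as typed);
all constants existential (functions of `d`, `ℓ`, windows).  Only the FIRST entry of (2.67) is certified here (the
derivative/Hölder/Laplacian entries and the walk form of (2.50) are not).  Nothing is inferred from the manuscript:
every step is kernel-checked.
-/

namespace Literature.MathematicalPhysics.QuantumFieldTheory.Balaban1983to89.B6Prop22MultiLevelBox

open Finset Matrix
open Literature.MathematicalPhysics.QuantumFieldTheory.Balaban1983to89.B4ContourShift (supNorm abs_le_supNorm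
  supNorm_nonneg)
open Literature.MathematicalPhysics.QuantumFieldTheory.Balaban1983to89.B4Reflection242 (boxDom mem_boxDom blk)
open Literature.MathematicalPhysics.QuantumFieldTheory.Balaban1983to89.B4Lemma22ReduceZero (Box)
open Literature.MathematicalPhysics.QuantumFieldTheory.Balaban1983to89.B4PartitionUnity22 (hprof D1 D2 D1_nonneg D2_nonneg
  contDiff_hprof hasCompactSupport_hprof)
open Literature.MathematicalPhysics.QuantumFieldTheory.Balaban1983to89.B4Thm110ZeroBox (boxCast boxCast_apply_val
  boxCast_symm_apply_val mem_boxDom_of_eq roww mulVec_le_of_roww)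
open Literature.MathematicalPhysics.QuantumFieldTheory.Balaban1983to89.B6Ineq243TwoLevelBox
open Literature.MathematicalPhysics.QuantumFieldTheory.Balaban1983to89.B6Partition236TwoLevelBox
open Literature.MathematicalPhysics.QuantumFieldTheory.Balaban1983to89.B6Eq238TwoLevelBox
open Literature.MathematicalPhysics.QuantumFieldTheory.Balaban1983to89.B6Ineq249TwoLevelBox (near card_near_le
  mem_near_of_abs_lt emb_sub_emb)
open Literature.MathematicalPhysics.QuantumFieldTheory.Balaban1983to89.B6MultiLevelBoxOperator
open Literature.MathematicalPhysics.QuantumFieldTheory.Balaban1983to89.B6Eq238MultiLevelBox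
open Literature.MathematicalPhysics.QuantumFieldTheory.Balaban1983to89.B6Ineq249MultiLevelBox
open Literature.MathematicalPhysics.QuantumFieldTheory.Balaban1983to89.B6Geom246MultiLevelBox
open Literature.MathematicalPhysics.QuantumFieldTheory.Balaban1983to89.B6RandomWalk (HasMajorant BlockSupp
  hasMajorant_mono)
open Literature.MathematicalPhysics.QuantumFieldTheory.Balaban1983to89.B6Ineq261LevelGap (K261 K261_nonneg
  theta_lt_one_of_log)
open Literature.MathematicalPhysics.QuantumFieldTheory.Balaban1983to89.B6Prop23Chain (majorant_of_fixedPoint_266W)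

noncomputable section

variable {d : ℕ}

/-! ## §1 Tools -/

section Tools

/-- a sum of terms `≤ B` (`B ≥ 0`), with at most the terms keyed (injectively) into `T` non-zero, is `≤ |T|·B`. [folklore] -/
private theorem sum_le_card_mul {ι σ : Type*} [Fintype ι] [DecidableEq σ] (f : ι → ℝ) (key : ι → σ)
    (hkey : Function.Injective key) (T : Finset σ) (hT : ∀ i, f i ≠ 0 → key i ∈ T) {B : ℝ} (hB : 0 ≤ B)
    (hf : ∀ i, f i ≤ B) : ∑ i, f i ≤ T.card * B := by
  classical
  rw [← Finset.sum_filter_ne_zero]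
  have hcard : (Finset.univ.filter fun i => f i ≠ 0).card ≤ T.card :=
    Finset.card_le_card_of_injOn key (fun i hi => by
      rw [Finset.coe_filter] at hi; exact hT i hi.2) (fun i _ j _ h => hkey h)
  calc ∑ i ∈ Finset.univ.filter (fun i => f i ≠ 0), f i
      ≤ (Finset.univ.filter fun i => f i ≠ 0).card • B := Finset.sum_le_card_nsmul _ _ _ fun i _ => hf i
    _ = ((Finset.univ.filter fun i => f i ≠ 0).card : ℝ) * B := by rw [nsmul_eq_mul]
    _ ≤ T.card * B := by gcongr

/-- `(reindex e e A)·v` at `z` is `A·(v ∘ e)` at `e⁻¹z`. [folklore] -/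
private theorem reindex_mulVec_apply {X Y : Type*} [Fintype X] [Fintype Y] (e : X ≃ Y) (A : Matrix X X ℝ) (v : Y → ℝ)
    (z : Y) : (Matrix.reindex e e A *ᵥ v) z = (A *ᵥ (v ∘ e)) (e.symm z) := by
  rw [Matrix.reindex_apply, Matrix.submatrix_mulVec_equiv, Equiv.symm_symm, Function.comp_apply]

/-- a block-supported function is bounded everywhere by its bound. [cite: Balaban1984PropagatorsII, (2.51) p.232, dictionary] -/
theorem BlockSupp.abs_le {g : B6.Geometry} {X : Type} {blkm : X → g.Site} {μ : X → ℝ} {y' : g.Site} {B : ℝ}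
    (h : BlockSupp blkm μ y' B) (x : X) : |μ x| ≤ B := by
  by_cases hx : blkm x = y'
  · exact h.bound x hx
  · rw [h.off x hx, abs_zero]; exact h.nonneg

/-- the exponent bookkeeping: `e^{−δD/L^i} = e^{δ}·e^{−(δ/(d+1))·dist}` for `D = L^i(dist/(d+1) − 1)`. [folklore] -/
private theorem exp_Dd_eq {δ n dist : ℝ} (hn : 0 < n) (d : ℕ) :
    Real.exp (-(δ * (n * (dist / (d + 1) - 1)) / n)) = Real.exp δ * Real.exp (-(δ / (d + 1) * dist)) := by
  rw [← Real.exp_add]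
  congr 1
  field_simp
  ring

end Tools

/-! ## §2 The cube geometry: levels and the distance inside an active cube -/

section CubeGeom

variable {ℓ Mh k R : ℕ} {P : Fin (d + 1) → ℕ} {D : Domains d ℓ Mh k P R}

/-- **EVERY BOX SITE OF AN ACTIVE CUBE HAS LEVEL `i_□` OR `i_□ + 1`** (file 2's two-level window, read on a site).
[cite: Balaban1984PropagatorsII, (2.2) p.224 with p.230] -/
theorem lev_window_of_inCube (hℓ : 1 ≤ ℓ) (hR : 2 * (ℓ + 1) ≤ R) (hP : ∀ μ, 1 ≤ P μ) (hMh : 1 ≤ Mh)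
    {cq : ℕ × (Fin (d + 1) → ℤ)} (hc : CubeData D cq) {w : Fin (d + 1) → ℤ} (hw : w ∈ boxDom (N0 ℓ Mh k P))
    (hin : InCube ℓ Mh k P cq.1 cq.2 w) : fin D cq.1 cq.2 ≤ D.lev w ∧ D.lev w ≤ fin D cq.1 cq.2 + 1 := by
  obtain ⟨hi1, hij, hji, hdown, hup⟩ := fin_data hc
  have hjk := hc.hj.2
  have hwP : w ∈ Box d ℓ (fin D cq.1 cq.2)
      (fun μ => (ℓ + 1) * (MhP ℓ Mh cq.1 (fin D cq.1 cq.2) * Pj ℓ k P cq.1 μ)) :=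
    mem_boxDom_of_eq (Np_eq hij hjk).symm hw
  obtain ⟨b, hb⟩ := (inCube_iff_exists_emb (Mh := Mh) hP hij hc.hq ⟨w, hwP⟩).1 hin
  have hwin := window_of_active (D := D) hℓ hR hP hMh hi1 hij hjk hc.hq hc.hact hdown hup b
  have hbw : (B6Eq238TwoLevelBox.emb ℓ (fin D cq.1 cq.2) (MhP ℓ Mh cq.1 (fin D cq.1 cq.2)) (Pj ℓ k P cq.1) cq.2 (one_le_Pj hP cq.1)
      hc.hq b).1 = w := congrArg Subtype.val hb
  rw [hbw] at hwin
  omega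

/-- the lattice box spanned by two points of a cube lies in the cube. [folklore] -/
private theorem inCube_of_hull {j : ℕ} {q z x'' w : Fin (d + 1) → ℤ} (hz : InCube ℓ Mh k P j q z)
    (hx : InCube ℓ Mh k P j q x'') (hw : ∀ μ, min (z μ) (x'' μ) ≤ w μ ∧ w μ ≤ max (z μ) (x'' μ)) :
    InCube ℓ Mh k P j q w := by
  intro μ
  obtain ⟨a1, a2⟩ := hz μ
  obtain ⟨b1, b2⟩ := hx μ
  obtain ⟨c1, c2⟩ := hw μ
  exact ⟨le_trans (le_min a1 b1) c1, lt_of_le_of_lt c2 (max_lt a2 b2)⟩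

/-- **`d` INSIDE AN ACTIVE CUBE**: two box sites of an active cube have blocks at graph distance
`≤ (d+1)(|z − x″|_∞/L^{i_□} + 1)` (file 4's staircase, every site in between having level `≥ i_□`).
[cite: Balaban1984PropagatorsII, p.231–232, dictionary] -/
theorem dist_blkOf_le_in_cube (hℓ : 1 ≤ ℓ) (hR : 2 * (ℓ + 1) ≤ R) (hP : ∀ μ, 1 ≤ P μ) (hMh : 1 ≤ Mh)
    {cq : ℕ × (Fin (d + 1) → ℤ)} (hc : CubeData D cq) (z x'' : ↥(boxDom (N0 ℓ Mh k P)))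
    (hz : InCube ℓ Mh k P cq.1 cq.2 z.1) (hx : InCube ℓ Mh k P cq.1 cq.2 x''.1) :
    (((bond D).dist (blkOf D z) (blkOf D x'') : ℕ) : ℝ)
      ≤ (d + 1) * (supNorm (z.1 - x''.1) / (((ℓ + 1) ^ fin D cq.1 cq.2 : ℕ) : ℝ) + 1) :=
  dist_blkOf_le_box hMh hP z x'' fun _ hw hhull =>
    (lev_window_of_inCube hℓ hR hP hMh hc hw (inCube_of_hull hz hx hhull)).1

/-- **THE SUPPORT DISTANCE FROM THE MULTISCALE DISTANCE**: with `D_□ = L^{i_□}(d(y(z), y′)/(d+1) − 1)`, every box site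
`x″` of the cube lying in the block `y′` is at sup-distance `≥ D_□` from `z`. [cite: Balaban1984PropagatorsII, p.232 ((2.53): the cube estimates in terms of d), dictionary] -/
theorem Dd_le_supNorm (hℓ : 1 ≤ ℓ) (hR : 2 * (ℓ + 1) ≤ R) (hP : ∀ μ, 1 ≤ P μ) (hMh : 1 ≤ Mh)
    {cq : ℕ × (Fin (d + 1) → ℤ)} (hc : CubeData D cq) (z x'' : ↥(boxDom (N0 ℓ Mh k P)))
    (hz : InCube ℓ Mh k P cq.1 cq.2 z.1) (hx : InCube ℓ Mh k P cq.1 cq.2 x''.1) (y' : ↥(bset D))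
    (hy' : blkOf D x'' = y') :
    (((ℓ + 1) ^ fin D cq.1 cq.2 : ℕ) : ℝ) * ((((bond D).dist (blkOf D z) y' : ℕ) : ℝ) / (d + 1) - 1)
      ≤ supNorm (z.1 - x''.1) := by
  have h := dist_blkOf_le_in_cube hℓ hR hP hMh hc z x'' hz hx
  rw [hy'] at h
  have hn : (0 : ℝ) < (((ℓ + 1) ^ fin D cq.1 cq.2 : ℕ) : ℝ) := by positivity
  have hd : (0 : ℝ) < (d : ℝ) + 1 := by positivity
  have h1 : (((bond D).dist (blkOf D z) y' : ℕ) : ℝ) / (d + 1)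
      ≤ supNorm (z.1 - x''.1) / (((ℓ + 1) ^ fin D cq.1 cq.2 : ℕ) : ℝ) + 1 := by
    rw [div_le_iff₀ hd]; linarith
  have h2 : (((bond D).dist (blkOf D z) y' : ℕ) : ℝ) / (d + 1) - 1
      ≤ supNorm (z.1 - x''.1) / (((ℓ + 1) ^ fin D cq.1 cq.2 : ℕ) : ℝ) := by linarith
  have := mul_le_mul_of_nonneg_left h2 hn.le
  rwa [mul_div_cancel₀ _ hn.ne'] at this

end CubeGeom

/-! ## §3 (2.64): the majorant of `R` on `𝔅` -/

section RMajorant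

variable {ℓ Mh k R : ℕ} {P : Fin (d + 1) → ℕ} {D : Domains d ℓ Mh k P R} {a c : ℕ → ℝ}

/-- the row of a term of `R` at a site of its cube is the row of the local commutator term. [cite: Balaban1984PropagatorsII, (2.38) p.229, dictionary] -/
theorem bX_row_img (hP : ∀ μ, 1 ≤ P μ) (cq : ℕ × (Fin (d + 1) → ℤ)) (hc : CubeData D cq)
    (v : ↥(boxDom (N0 ℓ Mh k P)) → ℝ) {z : ↥(boxDom (N0 ℓ Mh k P))}
    {y : ↥(Box d ℓ (fin D cq.1 cq.2)
      (fun μ => (ℓ + 1) * cubeM' (MhP ℓ Mh cq.1 (fin D cq.1 cq.2)) (Pj ℓ k P cq.1) cq.2 μ))}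
    (hy : embC D hP cq hc y = (castP (ℓ := ℓ) (Mh := Mh) (P := P) (fin_data hc).2.1 hc.hj.2).symm z) :
    (bX D a c hP cq hc *ᵥ v) z
      = ((kComm (cOp D a c cq.1 (fin D cq.1 cq.2) cq.2 hP hc.hq)
            (hLoc ℓ (fin D cq.1 cq.2) (MhP ℓ Mh cq.1 (fin D cq.1 cq.2)) (Pj ℓ k P cq.1) cq.2)
          * cG D a c cq.1 (fin D cq.1 cq.2) cq.2 hP hc.hq
          * Matrix.diagonal ((fun z => vFun D cq.1 cq.2 z.1) ∘ embC D hP cq hc))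
        *ᵥ (res (embC D hP cq hc) *ᵥ (v ∘ castP (fin_data hc).2.1 hc.hj.2))) y := by
  have hinj : Function.Injective (embC D hP cq hc) := emb_injective _ hc.hq
  rw [bX_mulVec_apply]
  unfold innerB
  rw [← Matrix.mulVec_mulVec, ← Matrix.mulVec_mulVec, ← hy, transpose_res_mulVec_img hinj]

/-- the row of a term of `R` off its cube vanishes. [cite: Balaban1984PropagatorsII, (2.38) p.229, dictionary] -/
theorem bX_row_off (hP : ∀ μ, 1 ≤ P μ) (cq : ℕ × (Fin (d + 1) → ℤ)) (hc : CubeData D cq)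
    (v : ↥(boxDom (N0 ℓ Mh k P)) → ℝ) {z : ↥(boxDom (N0 ℓ Mh k P))}
    (hne : ∀ y, embC D hP cq hc y ≠ (castP (ℓ := ℓ) (Mh := Mh) (P := P) (fin_data hc).2.1 hc.hj.2).symm z) :
    (bX D a c hP cq hc *ᵥ v) z = 0 := by
  rw [bX_mulVec_apply]
  unfold innerB
  rw [← Matrix.mulVec_mulVec, ← Matrix.mulVec_mulVec]
  exact transpose_res_mulVec_off _ _ hne

/-- **[B6] (2.64) FOR THE GENUINE `k`-LEVEL OPERATOR ON A BOX — THE MAJORANT OF `R` ON `𝔅`**: there are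
`δ₁, K > 0` (functions of `d`, `ℓ`, windows) such that for every `k`, `M_h ≥ 3`, `R ≥ 2L`, volume, nested family `D`
and weights in the windows, `|(Rλ)(x)| ≤ (K/M)·e^{−(δ₁/(d+1))·d(y,y′)}|λ|` for `x ∈ B^j(y)`, `supp λ ⊂ B^{j′}(y′)`
(`M = L·M_h`) — each term `K(h_□)G′(□)v_□` by file 3's decaying (2.44) on its cube with the support distance read
from `d` (§2), at most `3·2^{d+1}` terms per row. [cite: Balaban1984PropagatorsII, (2.64) p.234, (2.51)–(2.53) p.232, (2.44) p.230] -/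
theorem rML_majorant (d ℓ : ℕ) (hℓ : 1 ≤ ℓ) (aminus aplus a2minus a2plus : ℝ) (ha : 0 < aminus) (ha2 : 0 < a2minus) :
    ∃ δ₁ K : ℝ, 0 < δ₁ ∧ 0 < K ∧ ∀ (k Mh R : ℕ), 3 ≤ Mh → 2 * (ℓ + 1) ≤ R →
      ∀ (P : Fin (d + 1) → ℕ) (hP : ∀ μ, 1 ≤ P μ) (D : Domains d ℓ Mh k P R) (a c : ℕ → ℝ),
        (∀ i, 1 ≤ i → aminus ≤ a i ∧ a i ≤ aplus) → (∀ i, 1 ≤ i → a2minus ≤ c i ∧ c i ≤ a2plus) →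
        HasMajorant (g := geom D) (blkOf D) (Matrix.toLin' (rML D a c hP))
          (fun y y' => K / (((ℓ : ℝ) + 1) * Mh) * Real.exp (-(δ₁ / (d + 1) * (geom D).dist y y'))) := by
  obtain ⟨δ', C, hδ', hC, hloc⟩ := local_comm_bound d ℓ hℓ aminus aplus a2minus a2plus ha ha2
  have hD1 := D1_nonneg contDiff_hprof hasCompactSupport_hprof
  have hD2 := D2_nonneg contDiff_hprof hasCompactSupport_hprof
  set Cb : ℝ := C * ((d + 1) * (D1 hprof + D2 hprof)) with hCb
  have hCb0 : 0 ≤ Cb := by positivity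
  refine ⟨δ', (3 * 2 ^ (d + 1) * Cb + 1) * Real.exp δ', hδ', by positivity, ?_⟩
  intro k Mh R hMh hR P hP D a c haw hcw y' μ B hμ x
  have hMh1 : 1 ≤ Mh := le_trans (by norm_num) hMh
  have hL1 : (1 : ℝ) ≤ (ℓ : ℝ) + 1 := by linarith [(Nat.cast_nonneg ℓ : (0 : ℝ) ≤ ℓ)]
  set M : ℝ := ((ℓ : ℝ) + 1) * Mh with hMdef
  have hM1 : (1 : ℝ) ≤ M := by
    have : (1 : ℝ) ≤ Mh := by exact_mod_cast hMh1
    rw [hMdef]; nlinarith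
  have hMpos : 0 < M := by linarith
  have hμB : ∀ w, |μ w| ≤ B := fun w => BlockSupp.abs_le hμ w
  have hB0 : 0 ≤ B := hμ.nonneg
  rw [Matrix.toLin'_apply]
  -- the distance from the block of `x` to `y′`
  set dist0 : ℝ := (((bond D).dist (blkOf D x) y' : ℕ) : ℝ) with hdist0
  have hgeom : (geom D).dist (blkOf D x) y' = dist0 := rfl
  -- the bound of one term
  set E : ℝ := Cb / M * Real.exp δ' * Real.exp (-(δ' / (d + 1) * dist0)) * B with hE
  have hE0 : 0 ≤ E := by positivity
  have hterm : ∀ (cq : ℕ × (Fin (d + 1) → ℤ)) (hc : CubeData D cq), |(bX D a c hP cq hc *ᵥ μ) x| ≤ E := by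
    intro cq hc
    obtain ⟨hi1, hij, hji, -, -⟩ := fin_data hc
    have hjk := hc.hj.2
    by_cases himg : ∃ y, embC D hP cq hc y = (castP (ℓ := ℓ) (Mh := Mh) (P := P) hij hjk).symm x
    swap
    · push Not at himg
      rw [bX_row_off hP cq hc μ himg, abs_zero]; exact hE0
    obtain ⟨y, hy⟩ := himg
    have hzval : ((castP (ℓ := ℓ) (Mh := Mh) (P := P) hij hjk).symm x).1 = x.1 := by
      unfold castP; exact boxCast_symm_apply_val _ _
    have hyx : (embC D hP cq hc y).1 = x.1 := by rw [hy, hzval]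
    -- `x` lies in the cube
    have hxin : InCube ℓ Mh k P cq.1 cq.2 x.1 := by
      rw [← hzval]
      exact (inCube_iff_exists_emb (Mh := Mh) hP hij hc.hq _).2 ⟨y, hy⟩
    -- the cube data
    have hMh' : 1 ≤ MhP ℓ Mh cq.1 (fin D cq.1 cq.2) := one_le_MhP hMh1 _ _
    have hMhle : (Mh : ℝ) ≤ MhP ℓ Mh cq.1 (fin D cq.1 cq.2) := by
      unfold MhP; exact_mod_cast Nat.le_mul_of_pos_right _ (by positivity)
    have hMM' : M ≤ ((ℓ : ℝ) + 1) * (MhP ℓ Mh cq.1 (fin D cq.1 cq.2) : ℝ) := by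
      rw [hMdef]; exact mul_le_mul_of_nonneg_left hMhle (by linarith)
    have hn : (0 : ℝ) < (((ℓ + 1) ^ fin D cq.1 cq.2 : ℕ) : ℝ) := by positivity
    -- the support distance
    set Dd : ℝ := (((ℓ + 1) ^ fin D cq.1 cq.2 : ℕ) : ℝ) * (dist0 / (d + 1) - 1) with hDd
    have hw : ∀ b, |((fun z => vFun D cq.1 cq.2 z.1) ∘ embC D hP cq hc) b| ≤ 1 := fun b => abs_vFun_le_one _ _ _
    have hu : ∀ b, |(res (embC D hP cq hc) *ᵥ (μ ∘ castP (fin_data hc).2.1 hc.hj.2)) b| ≤ B := fun b => by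
      rw [res_mulVec]; exact hμB _
    have hsupp : ∀ b, (res (embC D hP cq hc) *ᵥ (μ ∘ castP (fin_data hc).2.1 hc.hj.2)) b ≠ 0 →
        Dd ≤ supNorm (y.1 - b.1) := by
      intro b hb
      rw [res_mulVec, Function.comp_apply] at hb
      -- the site `x″ = cast(emb b)` lies in the cube and in the block `y′`
      set x'' : ↥(boxDom (N0 ℓ Mh k P)) := castP (fin_data hc).2.1 hc.hj.2 (embC D hP cq hc b) with hx''
      have hx''val : x''.1 = (embC D hP cq hc b).1 := by
        rw [hx'']; unfold castP; exact boxCast_apply_val _ _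
      have hx''in : InCube ℓ Mh k P cq.1 cq.2 x''.1 := by
        rw [hx''val]
        exact (inCube_iff_exists_emb (Mh := Mh) hP hij hc.hq _).2 ⟨b, rfl⟩
      have hblk : blkOf D x'' = y' := by
        by_contra hne
        exact hb (hμ.off x'' hne)
      have h := Dd_le_supNorm hℓ hR hP hMh1 hc x x'' hxin hx''in y' hblk
      have hsub : x.1 - x''.1 = y.1 - b.1 := by
        rw [hx''val, ← hyx]; unfold embC; exact emb_sub_emb _ hc.hq y b
      rw [hsub] at h
      exact h
    -- (2.44) on the cube, in stages
    have h0 := hloc (fin D cq.1 cq.2) hi1 (a (fin D cq.1 cq.2)) (c (fin D cq.1 cq.2)) (haw _ hi1).1 (haw _ hi1).2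
      (hcw _ hi1).1 (hcw _ hi1).2 (MhP ℓ Mh cq.1 (fin D cq.1 cq.2)) hMh' (Pj ℓ k P cq.1) (one_le_Pj hP cq.1) cq.2
      hc.hq (lamLoc ℓ (MhP ℓ Mh cq.1 (fin D cq.1 cq.2)) (Pj ℓ k P cq.1) cq.2 (one_le_Pj hP cq.1) hc.hq
        (LamG D cq.1 (fin D cq.1 cq.2)))
      (isBlockUnion_lamLoc _ hc.hq (isBlockUnion_LamG (D := D) hij hjk))
    have h1 := h0 ((fun z => vFun D cq.1 cq.2 z.1) ∘ embC D hP cq hc)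
      (res (embC D hP cq hc) *ᵥ (μ ∘ castP (fin_data hc).2.1 hc.hj.2))
    have h2 := h1 B Dd
    have h3 := h2 hw
    have h4 := h3 hu
    have h5 := h4 y
    have h := h5 hsupp
    rw [bX_row_img hP cq hc μ hy]
    unfold embC at h
    unfold cOp cG embC
    refine h.trans ?_
    -- the constants: `C(d+1)(…)/M_□ ≤ Cb/M`, the exponent `e^{−δ′D/L^i} = e^{δ′}e^{−δ′dist/(d+1)}`
    have hκ : C * ((d + 1) * (D1 hprof + D2 hprof) / (((ℓ : ℝ) + 1) * (MhP ℓ Mh cq.1 (fin D cq.1 cq.2) : ℝ)))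
        ≤ Cb / M := by
      have hM'pos : (0 : ℝ) < ((ℓ : ℝ) + 1) * (MhP ℓ Mh cq.1 (fin D cq.1 cq.2) : ℝ) := lt_of_lt_of_le hMpos hMM'
      rw [hCb]
      calc C * ((d + 1) * (D1 hprof + D2 hprof) / (((ℓ : ℝ) + 1) * (MhP ℓ Mh cq.1 (fin D cq.1 cq.2) : ℝ)))
          = C * ((d + 1) * (D1 hprof + D2 hprof)) * (1 / (((ℓ : ℝ) + 1) * (MhP ℓ Mh cq.1 (fin D cq.1 cq.2) : ℝ))) := by
            ring
        _ ≤ C * ((d + 1) * (D1 hprof + D2 hprof)) * (1 / M) :=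
            mul_le_mul_of_nonneg_left (one_div_le_one_div_of_le hMpos hMM') (by positivity)
        _ = C * ((d + 1) * (D1 hprof + D2 hprof)) / M := by ring
    have hexp : Real.exp (-(δ' * Dd / (((ℓ + 1) ^ fin D cq.1 cq.2 : ℕ) : ℝ)))
        = Real.exp δ' * Real.exp (-(δ' / (d + 1) * dist0)) := by
      rw [hDd]; exact exp_Dd_eq hn d
    rw [hexp, hE]
    have : 0 ≤ Real.exp δ' * Real.exp (-(δ' / (d + 1) * dist0)) * B := by positivity
    calc C * ((d + 1) * (D1 hprof + D2 hprof) / (((ℓ : ℝ) + 1) * (MhP ℓ Mh cq.1 (fin D cq.1 cq.2) : ℝ)))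
          * (Real.exp δ' * Real.exp (-(δ' / (d + 1) * dist0))) * B
        = C * ((d + 1) * (D1 hprof + D2 hprof) / (((ℓ : ℝ) + 1) * (MhP ℓ Mh cq.1 (fin D cq.1 cq.2) : ℝ)))
          * (Real.exp δ' * Real.exp (-(δ' / (d + 1) * dist0)) * B) := by ring
      _ ≤ Cb / M * (Real.exp δ' * Real.exp (-(δ' / (d + 1) * dist0)) * B) := mul_le_mul_of_nonneg_right hκ this
      _ = Cb / M * Real.exp δ' * Real.exp (-(δ' / (d + 1) * dist0)) * B := by ring
  -- summing over the cover: at most `3·2^{d+1}` terms meet the row of `x`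
  unfold rML
  rw [Matrix.sum_mulVec, Finset.sum_apply, Finset.attach_eq_univ]
  refine (Finset.abs_sum_le_sum_abs _ _).trans ?_
  have key := sum_le_card_mul
    (fun cq : {cq // cq ∈ cubeSet D} => |(bX D a c hP cq.1 (cubeData_of_mem cq.2) *ᵥ μ) x|)
    (fun cq => cq.1) Subtype.val_injective (keySet ℓ Mh (D.lev x.1) x.1)
    (fun cq hq0 => mem_keySet_of_bX_ne_zero hℓ hR hP hMh cq.1 (cubeData_of_mem cq.2) μ
      (fun h0 => hq0 (by rw [h0, abs_zero])))
    hE0 (fun cq => hterm cq.1 (cubeData_of_mem cq.2))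
  refine key.trans ?_
  have hcard : ((keySet ℓ Mh (D.lev x.1) x.1).card : ℝ) ≤ 3 * 2 ^ (d + 1) := by
    exact_mod_cast card_keySet_le _ _ _ _
  dsimp only
  rw [hgeom]
  have hE' : 3 * 2 ^ (d + 1) * E
      ≤ (3 * 2 ^ (d + 1) * Cb + 1) * Real.exp δ' / M * Real.exp (-(δ' / (d + 1) * dist0)) * B := by
    rw [hE]
    have : 0 ≤ Real.exp δ' / M * Real.exp (-(δ' / (d + 1) * dist0)) * B := by positivity
    calc 3 * 2 ^ (d + 1) * (Cb / M * Real.exp δ' * Real.exp (-(δ' / (d + 1) * dist0)) * B)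
        = (3 * 2 ^ (d + 1) * Cb) * (Real.exp δ' / M * Real.exp (-(δ' / (d + 1) * dist0)) * B) := by ring
      _ ≤ (3 * 2 ^ (d + 1) * Cb + 1) * (Real.exp δ' / M * Real.exp (-(δ' / (d + 1) * dist0)) * B) :=
          mul_le_mul_of_nonneg_right (by linarith) this
      _ = _ := by ring
  calc ((keySet ℓ Mh (D.lev x.1) x.1).card : ℝ) * E ≤ 3 * 2 ^ (d + 1) * E :=
        mul_le_mul_of_nonneg_right hcard hE0
    _ ≤ (3 * 2 ^ (d + 1) * Cb + 1) * Real.exp δ' / M * Real.exp (-(δ' / (d + 1) * dist0)) * B := hE'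
    _ = (3 * 2 ^ (d + 1) * Cb + 1) * Real.exp δ' / (((ℓ : ℝ) + 1) * Mh) * Real.exp (-(δ' / (d + 1) * dist0)) * B := by
        rw [hMdef]

end RMajorant

/-! ## §4 The majorant of `G′₀` on `𝔅` -/

section GMajorant

variable {ℓ Mh k R : ℕ} {P : Fin (d + 1) → ℕ} {D : Domains d ℓ Mh k P R} {a c : ℕ → ℝ}

/-- the row of a term of `G′₀`: `(h_□G′(□)v_□μ)(z) = h_□(z)·(G′(□)(v_□μ))(z)`. [cite: Balaban1984PropagatorsII, (2.37) p.229, dictionary] -/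
theorem aX_mulVec_apply (hP : ∀ μ, 1 ≤ P μ) (cq : ℕ × (Fin (d + 1) → ℤ)) (hc : CubeData D cq)
    (v : ↥(boxDom (N0 ℓ Mh k P)) → ℝ) (z : ↥(boxDom (N0 ℓ Mh k P))) :
    (aX D a c hP cq hc *ᵥ v) z = uX cq z * (gX D a c hP cq hc *ᵥ (Matrix.diagonal (vX D cq) *ᵥ v)) z := by
  unfold aX
  rw [Matrix.mul_assoc, ← Matrix.mulVec_mulVec, Matrix.mulVec_diagonal, ← Matrix.mulVec_mulVec]

/-- the row of `G′(□)` (lattice units: `L^{2i_□}` times the cube propagator) at a site of the cube.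
[cite: Balaban1984PropagatorsII, (2.37) p.229, (2.42) p.230, dictionary] -/
theorem gX_row_img (hP : ∀ μ, 1 ≤ P μ) (cq : ℕ × (Fin (d + 1) → ℤ)) (hc : CubeData D cq)
    (w : ↥(boxDom (N0 ℓ Mh k P)) → ℝ) {z : ↥(boxDom (N0 ℓ Mh k P))}
    {y : ↥(Box d ℓ (fin D cq.1 cq.2)
      (fun μ => (ℓ + 1) * cubeM' (MhP ℓ Mh cq.1 (fin D cq.1 cq.2)) (Pj ℓ k P cq.1) cq.2 μ))}
    (hy : embC D hP cq hc y = (castP (ℓ := ℓ) (Mh := Mh) (P := P) (fin_data hc).2.1 hc.hj.2).symm z) :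
    (gX D a c hP cq hc *ᵥ w) z
      = ((((ℓ : ℝ) + 1)) ^ fin D cq.1 cq.2) ^ 2
          * (cG D a c cq.1 (fin D cq.1 cq.2) cq.2 hP hc.hq
              *ᵥ (res (embC D hP cq hc) *ᵥ (w ∘ castP (fin_data hc).2.1 hc.hj.2))) y := by
  have hinj : Function.Injective (B6Eq238TwoLevelBox.emb ℓ (fin D cq.1 cq.2) (MhP ℓ Mh cq.1 (fin D cq.1 cq.2))
      (Pj ℓ k P cq.1) cq.2 (one_le_Pj hP cq.1) hc.hq) := emb_injective _ hc.hq
  have key : (gX D a c hP cq hc *ᵥ w) z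
      = ((((ℓ : ℝ) + 1)) ^ fin D cq.1 cq.2) ^ 2
          * (cG D a c cq.1 (fin D cq.1 cq.2) cq.2 hP hc.hq
              *ᵥ (res (B6Eq238TwoLevelBox.emb ℓ (fin D cq.1 cq.2) (MhP ℓ Mh cq.1 (fin D cq.1 cq.2)) (Pj ℓ k P cq.1)
                  cq.2 (one_le_Pj hP cq.1) hc.hq) *ᵥ (w ∘ castP (fin_data hc).2.1 hc.hj.2))) y := by
    unfold gX
    rw [reindex_mulVec_apply, ← Matrix.mulVec_mulVec, ← Matrix.mulVec_mulVec, ← hy]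
    unfold embC
    rw [transpose_res_mulVec_img hinj, Matrix.smul_mulVec, Pi.smul_apply, smul_eq_mul]
  exact key

/-- the row of `G′(□)` off the cube vanishes. [cite: Balaban1984PropagatorsII, (2.37) p.229, dictionary] -/
theorem gX_row_off (hP : ∀ μ, 1 ≤ P μ) (cq : ℕ × (Fin (d + 1) → ℤ)) (hc : CubeData D cq)
    (w : ↥(boxDom (N0 ℓ Mh k P)) → ℝ) {z : ↥(boxDom (N0 ℓ Mh k P))}
    (hne : ∀ y, embC D hP cq hc y ≠ (castP (ℓ := ℓ) (Mh := Mh) (P := P) (fin_data hc).2.1 hc.hj.2).symm z) :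
    (gX D a c hP cq hc *ᵥ w) z = 0 := by
  unfold gX
  rw [reindex_mulVec_apply, ← Matrix.mulVec_mulVec, ← Matrix.mulVec_mulVec]
  exact transpose_res_mulVec_off _ _ hne

/-- **THE ROW SUPPORT OF A TERM OF `G′₀`**: if `(h_□G′(□)v_□μ)(z) ≠ 0` for the member `□ = (j, q)` of the cover, then
`h_□(z) ≠ 0`, so `z` lies in the cube (level `i_□` or `i_□ + 1`: `j ∈ {lev z − 1, lev z, lev z + 1}`) and `q` is one of
the `2^{d+1}` candidate centres at `z`. [cite: Balaban1984PropagatorsII, p.229 (cover of finite overlap), (2.36)–(2.37) p.229] -/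
theorem mem_keySet_of_aX_ne_zero (hℓ : 1 ≤ ℓ) (hR : 2 * (ℓ + 1) ≤ R) (hP : ∀ μ, 1 ≤ P μ) (hMh : 1 ≤ Mh)
    (cq : ℕ × (Fin (d + 1) → ℤ)) (hc : CubeData D cq) (v : ↥(boxDom (N0 ℓ Mh k P)) → ℝ)
    {z : ↥(boxDom (N0 ℓ Mh k P))} (hz : (aX D a c hP cq hc *ᵥ v) z ≠ 0) :
    cq ∈ keySet ℓ Mh (D.lev z.1) z.1 := by
  obtain ⟨hi1, hij, hji, hdown, hup⟩ := fin_data hc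
  have hjk := hc.hj.2
  rw [aX_mulVec_apply] at hz
  have hu : uX (ℓ := ℓ) (Mh := Mh) (k := k) (P := P) cq z ≠ 0 := fun h => hz (by rw [h, zero_mul])
  have hu' : hq ((ℓ + 1) ^ cq.1) ((ℓ + 1) * Mh) cq.2 z.1 ≠ 0 := hu
  have hN1 : 1 ≤ (ℓ + 1) ^ cq.1 * ((ℓ + 1) * Mh) := Nat.one_le_iff_ne_zero.2 (by positivity)
  -- (b) the candidate centres
  have hnear : cq.2 ∈ near (bigSide ℓ Mh cq.1) z.1 := by
    refine mem_near_of_abs_lt (one_le_bigSide hMh cq.1) fun μ => ?_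
    have h := abs_lt_of_hq_ne_zero hN1 hu' μ
    have hNM : (ℓ + 1) ^ cq.1 * ((ℓ + 1) * Mh) = bigSide ℓ Mh cq.1 := by rw [bigSide_eq]; ring
    rw [hNM] at h
    have hpos : (0 : ℝ) ≤ ((bigSide ℓ Mh cq.1 : ℕ) : ℝ) := by positivity
    exact h.trans_le (by linarith)
  -- (a) the level window: `z` lies in the cube
  have hzP : z.1 ∈ Box d ℓ (fin D cq.1 cq.2)
      (fun μ => (ℓ + 1) * (MhP ℓ Mh cq.1 (fin D cq.1 cq.2) * Pj ℓ k P cq.1 μ)) :=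
    mem_boxDom_of_eq (Np_eq hij hjk).symm z.2
  have hΩz : hΩ ℓ (fin D cq.1 cq.2) (MhP ℓ Mh cq.1 (fin D cq.1 cq.2)) (Pj ℓ k P cq.1) cq.2 ⟨z.1, hzP⟩ ≠ 0 := by
    rw [← uFun_eq_hΩ hij cq.2 ⟨z.1, hzP⟩]; exact hu
  obtain ⟨b, hb⟩ := exists_emb_eq_of_hΩ_ne_zero hℓ hi1 (one_le_MhP hMh cq.1 (fin D cq.1 cq.2)) (one_le_Pj hP cq.1)
    hc.hq hΩz
  have hwin := window_of_active (D := D) hℓ hR hP hMh hi1 hij hjk hc.hq hc.hact hdown hup b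
  have hbz : (B6Eq238TwoLevelBox.emb ℓ (fin D cq.1 cq.2) (MhP ℓ Mh cq.1 (fin D cq.1 cq.2)) (Pj ℓ k P cq.1) cq.2
      (one_le_Pj hP cq.1) hc.hq b).1 = z.1 := congrArg Subtype.val hb
  rw [hbz] at hwin
  exact mem_keySet (by omega) (by omega) hnear

/-- **THE MAJORANT OF `G′₀` ON `𝔅` FOR THE GENUINE `k`-LEVEL OPERATOR**: there are `δ₂, A > 0` (functions of `d`, `ℓ`,
windows) such that for every `k`, `M_h ≥ 3`, `R ≥ 2L`, volume, nested family `D` and weights in the windows,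
`|(G′₀λ)(x)| ≤ A·L^{2j}·e^{−(δ₂/(d+1))·d(y,y′)}|λ|` for `x ∈ B^j(y)`, `supp λ ⊂ B^{j′}(y′)` — each term `h_□G′(□)v_□`
by (2.43) on its cube (`B6Ineq243TwoLevelBox.ineq243_twoLevel_roww`) in the decaying form
`B4Thm110ZeroBox.mulVec_le_of_roww`, the lattice-unit factor `L^{2i_□} ≤ L^{2j}`, the support distance read from `d`
(§2), and at most `3·2^{d+1}` terms per row. [cite: Balaban1984PropagatorsII, (2.66) p.234 (the G′₀ factor «O(1)(L^jη)²»), (2.43) p.230, (2.53) p.232] -/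
theorem gZeroML_majorant (d ℓ : ℕ) (hℓ : 1 ≤ ℓ) (aminus aplus a2minus a2plus : ℝ) (ha : 0 < aminus)
    (ha2 : 0 < a2minus) :
    ∃ δ₂ A : ℝ, 0 < δ₂ ∧ 0 < A ∧ ∀ (k Mh R : ℕ), 3 ≤ Mh → 2 * (ℓ + 1) ≤ R →
      ∀ (P : Fin (d + 1) → ℕ) (hP : ∀ μ, 1 ≤ P μ) (D : Domains d ℓ Mh k P R) (a c : ℕ → ℝ),
        (∀ i, 1 ≤ i → aminus ≤ a i ∧ a i ≤ aplus) → (∀ i, 1 ≤ i → a2minus ≤ c i ∧ c i ≤ a2plus) →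
        HasMajorant (g := geom D) (blkOf D) (Matrix.toLin' (gZeroML D a c hP))
          (fun y y' => A * ((ℓ : ℝ) + 1) ^ (2 * y.1.1) * Real.exp (-(δ₂ / (d + 1) * (geom D).dist y y'))) := by
  obtain ⟨δ'', c', hδ'', hc', h243⟩ := ineq243_twoLevel_roww d ℓ hℓ aminus aplus 0 a2minus a2plus ha ha2
  refine ⟨δ'', 3 * 2 ^ (d + 1) * c' * Real.exp δ'', hδ'', by positivity, ?_⟩
  intro k Mh R hMh hR P hP D a c haw hcw y' μ B hμ x
  have hMh1 : 1 ≤ Mh := le_trans (by norm_num) hMh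
  have hL1 : (1 : ℝ) ≤ (ℓ : ℝ) + 1 := by linarith [(Nat.cast_nonneg ℓ : (0 : ℝ) ≤ ℓ)]
  have hμB : ∀ w, |μ w| ≤ B := fun w => BlockSupp.abs_le hμ w
  have hB0 : 0 ≤ B := hμ.nonneg
  rw [Matrix.toLin'_apply]
  set dist0 : ℝ := (((bond D).dist (blkOf D x) y' : ℕ) : ℝ) with hdist0
  have hgeom : (geom D).dist (blkOf D x) y' = dist0 := rfl
  have hlevx : (blkOf D x).1.1 = D.lev x.1 := rfl
  -- the bound of one term
  set E : ℝ := ((ℓ : ℝ) + 1) ^ (2 * D.lev x.1) * (c' * Real.exp δ'' * Real.exp (-(δ'' / (d + 1) * dist0)) * B)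
    with hE
  have hE0 : 0 ≤ E := by positivity
  have hterm : ∀ (cq : ℕ × (Fin (d + 1) → ℤ)) (hc : CubeData D cq), |(aX D a c hP cq hc *ᵥ μ) x| ≤ E := by
    intro cq hc
    obtain ⟨hi1, hij, hji, -, -⟩ := fin_data hc
    have hjk := hc.hj.2
    rw [aX_mulVec_apply]
    by_cases himg : ∃ y, embC D hP cq hc y = (castP (ℓ := ℓ) (Mh := Mh) (P := P) hij hjk).symm x
    swap
    · push Not at himg
      rw [gX_row_off hP cq hc _ himg, mul_zero, abs_zero]; exact hE0
    obtain ⟨y, hy⟩ := himg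
    have hzval : ((castP (ℓ := ℓ) (Mh := Mh) (P := P) hij hjk).symm x).1 = x.1 := by
      unfold castP; exact boxCast_symm_apply_val _ _
    have hyx : (embC D hP cq hc y).1 = x.1 := by rw [hy, hzval]
    have hxin : InCube ℓ Mh k P cq.1 cq.2 x.1 := by
      rw [← hzval]
      exact (inCube_iff_exists_emb (Mh := Mh) hP hij hc.hq _).2 ⟨y, hy⟩
    have hlevwin := lev_window_of_inCube hℓ hR hP hMh1 hc x.2 hxin
    have hMh' : 1 ≤ MhP ℓ Mh cq.1 (fin D cq.1 cq.2) := one_le_MhP hMh1 _ _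
    have hcM' : ∀ μ, 1 ≤ cubeM' (MhP ℓ Mh cq.1 (fin D cq.1 cq.2)) (Pj ℓ k P cq.1) cq.2 μ := fun μ =>
      Nat.one_le_iff_ne_zero.2 (Nat.mul_ne_zero_iff.2
        ⟨by omega, by have := (one_le_cubeW (one_le_Pj hP cq.1) hc.hq μ).1; omega⟩)
    have hn : (0 : ℝ) < (((ℓ + 1) ^ fin D cq.1 cq.2 : ℕ) : ℝ) := by positivity
    set Dd : ℝ := (((ℓ + 1) ^ fin D cq.1 cq.2 : ℕ) : ℝ) * (dist0 / (d + 1) - 1) with hDd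
    -- the vector `u = res(v_□μ ∘ cast)` on the cube
    have hF : ∀ b, |(res (embC D hP cq hc) *ᵥ ((Matrix.diagonal (vX D cq) *ᵥ μ) ∘ castP (fin_data hc).2.1 hc.hj.2)) b|
        ≤ B := by
      intro b
      rw [res_mulVec, Function.comp_apply, Matrix.mulVec_diagonal, abs_mul]
      calc |vX D cq _| * |μ _| ≤ 1 * B := mul_le_mul (abs_vFun_le_one _ _ _) (hμB _) (abs_nonneg _) zero_le_one
        _ = B := one_mul _
    have hD : ∀ b, (res (embC D hP cq hc) *ᵥ ((Matrix.diagonal (vX D cq) *ᵥ μ) ∘ castP (fin_data hc).2.1 hc.hj.2)) b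
        ≠ 0 → Dd ≤ supNorm (y.1 - b.1) := by
      intro b hb
      rw [res_mulVec, Function.comp_apply, Matrix.mulVec_diagonal] at hb
      set x'' : ↥(boxDom (N0 ℓ Mh k P)) := castP (fin_data hc).2.1 hc.hj.2 (embC D hP cq hc b) with hx''
      have hμx : μ x'' ≠ 0 := fun h0 => hb (by rw [h0, mul_zero])
      have hx''val : x''.1 = (embC D hP cq hc b).1 := by
        rw [hx'']; unfold castP; exact boxCast_apply_val _ _
      have hx''in : InCube ℓ Mh k P cq.1 cq.2 x''.1 := by
        rw [hx''val]
        exact (inCube_iff_exists_emb (Mh := Mh) hP hij hc.hq _).2 ⟨b, rfl⟩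
      have hblk : blkOf D x'' = y' := by
        by_contra hne
        exact hμx (hμ.off x'' hne)
      have h := Dd_le_supNorm hℓ hR hP hMh1 hc x x'' hxin hx''in y' hblk
      have hsub : x.1 - x''.1 = y.1 - b.1 := by
        rw [hx''val, ← hyx]; unfold embC; exact emb_sub_emb _ hc.hq y b
      rw [hsub] at h
      exact h
    -- (2.43) on the cube, in the decaying form
    have hrow : roww δ'' ((ℓ + 1) ^ fin D cq.1 cq.2) (cG D a c cq.1 (fin D cq.1 cq.2) cq.2 hP hc.hq) y ≤ c' :=
      h243 (fin D cq.1 cq.2) hi1 (a (fin D cq.1 cq.2)) 0 (c (fin D cq.1 cq.2)) (haw _ hi1).1 (haw _ hi1).2 le_rfl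
        le_rfl (hcw _ hi1).1 (hcw _ hi1).2 _ hcM' _ y
    have hdec := mulVec_le_of_roww hδ''.le ((ℓ + 1) ^ fin D cq.1 cq.2)
      (cG D a c cq.1 (fin D cq.1 cq.2) cq.2 hP hc.hq) y hrow _ hF hD
    rw [gX_row_img hP cq hc _ hy, abs_mul, abs_mul]
    -- `|h_□| ≤ 1`, `(L^i)² ≤ L^{2·lev x}`, the exponent bookkeeping
    have huX : |uX (ℓ := ℓ) (Mh := Mh) (k := k) (P := P) cq x| ≤ 1 := abs_hq_le_one _ _ _ _
    have hsq : |((((ℓ : ℝ) + 1)) ^ fin D cq.1 cq.2) ^ 2| ≤ ((ℓ : ℝ) + 1) ^ (2 * D.lev x.1) := by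
      rw [abs_of_nonneg (by positivity), ← pow_mul]
      exact pow_le_pow_right₀ hL1 (by omega)
    have hexp : Real.exp (-(δ'' * Dd / (((ℓ + 1) ^ fin D cq.1 cq.2 : ℕ) : ℝ)))
        = Real.exp δ'' * Real.exp (-(δ'' / (d + 1) * dist0)) := by
      rw [hDd]; exact exp_Dd_eq hn d
    rw [hexp] at hdec
    have h3 : 0 ≤ c' * (Real.exp δ'' * Real.exp (-(δ'' / (d + 1) * dist0))) * B := by positivity
    rw [hE]
    calc |uX cq x| * (|((((ℓ : ℝ) + 1)) ^ fin D cq.1 cq.2) ^ 2| * |(cG D a c cq.1 (fin D cq.1 cq.2) cq.2 hP hc.hq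
            *ᵥ (res (embC D hP cq hc) *ᵥ ((Matrix.diagonal (vX D cq) *ᵥ μ) ∘ castP (fin_data hc).2.1 hc.hj.2))) y|)
        ≤ 1 * (((ℓ : ℝ) + 1) ^ (2 * D.lev x.1) * (c' * (Real.exp δ'' * Real.exp (-(δ'' / (d + 1) * dist0))) * B)) :=
          mul_le_mul huX (mul_le_mul hsq hdec (abs_nonneg _) (by positivity)) (by positivity) zero_le_one
      _ = ((ℓ : ℝ) + 1) ^ (2 * D.lev x.1) * (c' * Real.exp δ'' * Real.exp (-(δ'' / (d + 1) * dist0)) * B) := by ring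
  -- summing over the cover
  unfold gZeroML
  rw [Matrix.sum_mulVec, Finset.sum_apply, Finset.attach_eq_univ]
  refine (Finset.abs_sum_le_sum_abs _ _).trans ?_
  have key := sum_le_card_mul
    (fun cq : {cq // cq ∈ cubeSet D} => |(aX D a c hP cq.1 (cubeData_of_mem cq.2) *ᵥ μ) x|)
    (fun cq => cq.1) Subtype.val_injective (keySet ℓ Mh (D.lev x.1) x.1)
    (fun cq hq0 => mem_keySet_of_aX_ne_zero hℓ hR hP hMh1 cq.1 (cubeData_of_mem cq.2) μ
      (fun h0 => hq0 (by rw [h0, abs_zero])))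
    hE0 (fun cq => hterm cq.1 (cubeData_of_mem cq.2))
  refine key.trans ?_
  have hcard : ((keySet ℓ Mh (D.lev x.1) x.1).card : ℝ) ≤ 3 * 2 ^ (d + 1) := by
    exact_mod_cast card_keySet_le _ _ _ _
  dsimp only
  rw [hgeom, hlevx]
  calc ((keySet ℓ Mh (D.lev x.1) x.1).card : ℝ) * E ≤ 3 * 2 ^ (d + 1) * E :=
        mul_le_mul_of_nonneg_right hcard hE0
    _ = 3 * 2 ^ (d + 1) * c' * Real.exp δ'' * ((ℓ : ℝ) + 1) ^ (2 * D.lev x.1)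
          * Real.exp (-(δ'' / (d + 1) * dist0)) * B := by rw [hE]; ring

end GMajorant

/-! ## §5 Proposition 2.2, first entry, for the genuine `k`-level operator -/

section Prop22

variable {ℓ Mh k R : ℕ} {P : Fin (d + 1) → ℕ}

/-- **THE FIXED POINT `G′ = G′₀ + G′R`** of (2.38)/(2.50) for the genuine operator, as linear maps: from
`Δ′_aG′₀ = 1 − R` (file 2) and `G′Δ′_a = 1` (file 1/3). [cite: Balaban1984PropagatorsII, (2.38) p.229, (2.50) p.232] -/
theorem fixedPoint_gml (D : Domains d ℓ Mh k P R) {a c : ℕ → ℝ} (hℓ : 1 ≤ ℓ) (hR : 2 * (ℓ + 1) ≤ R)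
    (hP : ∀ μ, 1 ≤ P μ) (hMh : 1 ≤ Mh) (ha : ∀ i, 1 ≤ i → 0 < a i) (hcpos : ∀ i, 1 ≤ i → 0 < c i)
    (hac : ∀ i, 1 ≤ i → a (i + 1) = aNext ℓ (a i) (c i)) :
    Matrix.toLin' (gml (N0 ℓ Mh k P) ℓ k D.lev a)
      = Matrix.toLin' (gZeroML D a c hP)
        + Matrix.toLin' (gml (N0 ℓ Mh k P) ℓ k D.lev a) * Matrix.toLin' (rML D a c hP) := by
  have h238 := eq238_multiLevelBox (D := D) (a := a) (c := c) hℓ hR hP hMh ha hcpos hac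
  have hGE : gml (N0 ℓ Mh k P) ℓ k D.lev a * mlOp (N0 ℓ Mh k P) ℓ k D.lev a = 1 :=
    gml_mul_mlOp_pos (fun μ => Nat.one_le_iff_ne_zero.2 (by have := hP μ; positivity)) D.one_le_lev D.lev_le ha
  have hmat : gml (N0 ℓ Mh k P) ℓ k D.lev a
      = gZeroML D a c hP + gml (N0 ℓ Mh k P) ℓ k D.lev a * rML D a c hP := by
    have h := congrArg (fun T => gml (N0 ℓ Mh k P) ℓ k D.lev a * T) h238
    rw [← Matrix.mul_assoc, hGE, Matrix.one_mul, Matrix.mul_sub, Matrix.mul_one] at h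
    rw [h]; abel
  conv_lhs => rw [hmat]
  rw [map_add, Module.End.mul_eq_comp, ← Matrix.toLin'_mul]

/-- **[B6] PROPOSITION 2.2, FIRST ENTRY OF (2.67), FOR THE GENUINE `k`-LEVEL OPERATOR `G′ = Δ′_a^{−1}` ON A BOX**:
there are `δ₀, C, M₀ > 0` and `N₀ ≥ 1` (functions of `d`, `ℓ` and the windows) such that for EVERY number of levels `k`,
`M_h ≥ 3` with `L·M_h ≥ M₀` («M is sufficiently large»), `R ≥ 2L` with `RM ≥ N₀ + 1` ((2.59)), volume `P`, nested
family `D` of domains (2.1)–(2.2), and weights `a_i ∈ [a₋, a₊]`, `c_i ∈ [c₋, c₊]` with `a_{i+1} = aNext ℓ a_i c_i`: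
`|(G′λ)(x)| ≤ C·L^{2j}·e^{−½δ₀d(y,y′)}·|λ|` for `x ∈ B^j(y)`, `y ∈ Λ_j`, `supp λ ⊂ B^{j′}(y′)`, `y′ ∈ Λ_{j′}`
(`HasMajorant`, lattice units: `L^{2j}` for «(L^jη)²») — by the printed route: the majorants of `R` ((2.64), §3) and of
`G′₀` (§4), Lemma 2.1 on the box (file 4) and the chain (2.64)–(2.66) (`B6Prop23Chain.majorant_of_fixedPoint_266W`)
applied to the fixed point `G′ = G′₀ + G′R`. [cite: Balaban1984PropagatorsII, Proposition 2.2 (2.67) p.234, (2.64)–(2.66) p.234] -/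
theorem prop22_first_multiLevelBox (d ℓ : ℕ) (hℓ : 1 ≤ ℓ) (aminus aplus a2minus a2plus : ℝ) (ha : 0 < aminus)
    (ha2 : 0 < a2minus) :
    ∃ δ₀ C M₀ : ℝ, ∃ N₀ : ℕ, 0 < δ₀ ∧ 0 < C ∧ 0 < M₀ ∧ 0 < N₀ ∧
      ∀ (k Mh R : ℕ), 3 ≤ Mh → M₀ ≤ ((ℓ : ℝ) + 1) * Mh → 2 * (ℓ + 1) ≤ R → N₀ + 1 ≤ R * ((ℓ + 1) * Mh) →
      ∀ (P : Fin (d + 1) → ℕ) (hP : ∀ μ, 1 ≤ P μ) (D : Domains d ℓ Mh k P R) (a c : ℕ → ℝ),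
        (∀ i, 1 ≤ i → aminus ≤ a i ∧ a i ≤ aplus) → (∀ i, 1 ≤ i → a2minus ≤ c i ∧ c i ≤ a2plus) →
        (∀ i, 1 ≤ i → a (i + 1) = aNext ℓ (a i) (c i)) →
        HasMajorant (g := geom D) (blkOf D) (Matrix.toLin' (gml (N0 ℓ Mh k P) ℓ k D.lev a))
          (fun y y' => C * ((ℓ : ℝ) + 1) ^ (2 * y.1.1) * Real.exp (-(δ₀ / 2 * (geom D).dist y y'))) := by
  obtain ⟨δ₁, K, hδ₁, hK, hRmaj⟩ := rML_majorant d ℓ hℓ aminus aplus a2minus a2plus ha ha2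
  obtain ⟨δ₂, A, hδ₂, hA, hGmaj⟩ := gZeroML_majorant d ℓ hℓ aminus aplus a2minus a2plus ha ha2
  have hL0 : (0 : ℝ) < (ℓ : ℝ) + 1 := by positivity
  have hL1 : (1 : ℝ) ≤ (ℓ : ℝ) + 1 := by linarith [(Nat.cast_nonneg ℓ : (0 : ℝ) ≤ ℓ)]
  -- the rate `δ₀ = min(δ₁, δ₂)/(d+1)` and the (2.59)-threshold `N₀`
  set δ₀ : ℝ := min δ₁ δ₂ / (d + 1) with hδ₀
  have hδ₀pos : 0 < δ₀ := by rw [hδ₀]; exact div_pos (lt_min hδ₁ hδ₂) (by positivity)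
  set N₀ : ℕ := ⌈4 * ((d : ℝ) + 1) * ((ℓ : ℝ) + 1) / (1 / 2 * δ₀)⌉₊ + 1 with hN₀
  have hN₀pos : 0 < N₀ := by rw [hN₀]; omega
  have hθlt : Real.exp (-(1 / 2 * δ₀)) * ((ℓ : ℝ) + 1) ^ ((2 * (d + 1 : ℕ) : ℝ) / N₀) < 1 := by
    refine theta_lt_one_of_log hL0 hN₀pos ?_
    have hlog : Real.log ((ℓ : ℝ) + 1) ≤ (ℓ : ℝ) + 1 := (Real.log_le_sub_one_of_pos hL0).trans (by linarith)
    have hN₀ge : 4 * ((d : ℝ) + 1) * ((ℓ : ℝ) + 1) / (1 / 2 * δ₀) < (N₀ : ℝ) := by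
      rw [hN₀]; push_cast
      exact lt_of_le_of_lt (Nat.le_ceil _) (by linarith)
    have hσ : (0 : ℝ) < 1 / 2 * δ₀ := by positivity
    rw [div_lt_iff₀ hσ] at hN₀ge
    push_cast
    nlinarith [mul_nonneg (by positivity : (0 : ℝ) ≤ 2 * ((d : ℝ) + 1)) (Real.log_nonneg hL1)]
  -- the (2.61)-constant and «M sufficiently large»
  set cK : ℝ := K261 N₀ (d + 1) ((ℓ : ℝ) + 1) 1 (1 / 2 * δ₀) with hcK
  have hcK0 : 0 ≤ cK := K261_nonneg (by positivity) zero_le_one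
  set M₀ : ℝ := 2 * K * cK + 1 with hM₀
  refine ⟨δ₀, 2 * A * cK + 1, M₀, N₀, hδ₀pos, by positivity, by positivity, hN₀pos, ?_⟩
  intro k Mh R hMh hM hR hRM P hP D a c haw hcw hac
  have hMh1 : 1 ≤ Mh := le_trans (by norm_num) hMh
  have hMpos : (0 : ℝ) < ((ℓ : ℝ) + 1) * Mh := by
    have : (1 : ℝ) ≤ Mh := by exact_mod_cast hMh1
    positivity
  -- the majorants of `R` and `G′₀`, at the common rate `δ₀`
  set θ : ℝ := K / (((ℓ : ℝ) + 1) * Mh) with hθ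
  have hθ0 : 0 ≤ θ := by positivity
  have hdnn : ∀ y y' : (geom D).Site, 0 ≤ (geom D).dist y y' := (triangle_refl_nonneg D hMh1 hP).2.2
  have hrate : ∀ (δ : ℝ), min δ₁ δ₂ ≤ δ → ∀ y y' : (geom D).Site,
      Real.exp (-(δ / (d + 1) * (geom D).dist y y')) ≤ Real.exp (-(δ₀ * (geom D).dist y y')) := by
    intro δ hδ y y'
    rw [Real.exp_le_exp, hδ₀, neg_le_neg_iff]
    exact mul_le_mul_of_nonneg_right (div_le_div_of_nonneg_right hδ (by positivity)) (hdnn y y')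
  have hRm : HasMajorant (g := geom D) (blkOf D) (Matrix.toLin' (rML D a c hP))
      (fun y y' => θ * Real.exp (-(δ₀ * (geom D).dist y y'))) :=
    hasMajorant_mono (blkOf D) (hRmaj k Mh R hMh hR P hP D a c haw hcw) fun y y' =>
      mul_le_mul_of_nonneg_left (hrate δ₁ (min_le_left _ _) y y') hθ0
  have hGm : HasMajorant (g := geom D) (blkOf D) (Matrix.toLin' (gZeroML D a c hP))
      (fun y y' => A * ((ℓ : ℝ) + 1) ^ (2 * y.1.1) * Real.exp (-(δ₀ * (geom D).dist y y'))) :=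
    hasMajorant_mono (blkOf D) (hGmaj k Mh R hMh hR P hP D a c haw hcw) fun y y' =>
      mul_le_mul_of_nonneg_left (hrate δ₂ (min_le_right _ _) y y') (by positivity)
  -- Lemma 2.1 on the box with `α = ½`
  obtain ⟨-, h261, -, h263⟩ := lemma21_box D hMh1 hP hN₀pos hRM hδ₀pos.le (α := 1 / 2) (by norm_num)
    (by norm_num) hθlt
  obtain ⟨htri, hrefl, -⟩ := triangle_refl_nonneg D hMh1 hP
  -- the smallness `θ·c < 1` from `M ≥ M₀`
  have hsmall : θ * cK ≤ 1 / 2 := by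
    rw [hθ, div_mul_eq_mul_div, div_le_iff₀ hMpos]
    have : 2 * K * cK + 1 ≤ ((ℓ : ℝ) + 1) * Mh := hM
    nlinarith
  have hsmall' : θ * cK < 1 := by linarith
  -- the fixed point and the chain
  have hfix := fixedPoint_gml D (c := c) hℓ hR hP hMh1 (fun i hi => lt_of_lt_of_le ha (haw i hi).1)
    (fun i hi => lt_of_lt_of_le ha2 (hcw i hi).1) hac
  have hchain := majorant_of_fixedPoint_266W (g := geom D) (blkOf D) cK δ₀ (1 / 2) θ A
    (fun y => ((ℓ : ℝ) + 1) ^ (2 * y.1.1)) hA.le (fun y => by positivity) hθ0 hcK0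
    (by nlinarith [hδ₀pos.le] : (0 : ℝ) ≤ (1 - 1 / 2) * δ₀) htri hrefl hdnn h261 h263 hsmall' hGm hRm hfix
  refine hasMajorant_mono (g := geom D) (blkOf D) hchain fun y y' => ?_
  have hinv : (1 - θ * cK)⁻¹ ≤ 2 := by
    rw [inv_le_comm₀ (by linarith) (by norm_num)]; linarith
  have hexp0 : 0 ≤ Real.exp (-((1 - 1 / 2) * δ₀ * (geom D).dist y y')) := (Real.exp_pos _).le
  have hP0 : 0 ≤ ((ℓ : ℝ) + 1) ^ (2 * y.1.1) := by positivity
  have hrate2 : Real.exp (-((1 - 1 / 2) * δ₀ * (geom D).dist y y')) = Real.exp (-(δ₀ / 2 * (geom D).dist y y')) := by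
    congr 1; ring
  rw [← hrate2]
  have h1 : A * cK * (1 - θ * cK)⁻¹ ≤ 2 * A * cK + 1 := by
    have : A * cK * (1 - θ * cK)⁻¹ ≤ A * cK * 2 := mul_le_mul_of_nonneg_left hinv (by positivity)
    linarith
  calc A * cK * (1 - θ * cK)⁻¹ * ((ℓ : ℝ) + 1) ^ (2 * y.1.1) * Real.exp (-((1 - 1 / 2) * δ₀ * (geom D).dist y y'))
      = A * cK * (1 - θ * cK)⁻¹ * (((ℓ : ℝ) + 1) ^ (2 * y.1.1) * Real.exp (-((1 - 1 / 2) * δ₀ * (geom D).dist y y'))) := by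
        ring
    _ ≤ (2 * A * cK + 1) * (((ℓ : ℝ) + 1) ^ (2 * y.1.1) * Real.exp (-((1 - 1 / 2) * δ₀ * (geom D).dist y y'))) :=
        mul_le_mul_of_nonneg_right h1 (mul_nonneg hP0 hexp0)
    _ = (2 * A * cK + 1) * ((ℓ : ℝ) + 1) ^ (2 * y.1.1) * Real.exp (-((1 - 1 / 2) * δ₀ * (geom D).dist y y')) := by
        ring

end Prop22

end

end Literature.MathematicalPhysics.QuantumFieldTheory.Balaban1983to89.B6Prop22MultiLevelBox
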